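import Literature.NumberTheory.Automorphic.UnitaryGroupInertPlaceHyperbolicBasis     -- ★ `exists_toPlace_eq_of_galAdicCompletionMap_eq`, `galAdicCompletionMap_galAdicCompletionMap_of_smul_eq`
import Literature.NumberTheory.Automorphic.Liu2021.FinAdelicCheckSurjective            -- ★ Hilbert 90 `exists_ne_zero_mul_galAdicCompletionMap_eq`
import Literature.NumberTheory.Automorphic.UnitaryGroupSplitPlace                      -- ★ `algEquiv_mul_self_eq_one`
import HarnessLib

/-!
# `U(1,1)` modulo its centre is a subgroup of `PGL₂(F)`: for `u ∈ U(σ, Φ₂)`, `σ(u) = (det u)⁻¹ · DuD` and `diag(1,α) u diag(1,α)⁻¹ ∈ E^× · GL₂(F)`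
(Serre, *Trees* II.1.2–1.3: the action of `GL₂` on the tree; Tits (1979) §2.7, §3.9 and Bruhat–Tits (1984) §4.2: the building of a ramified quasi-split unitary group
in two variables is the tree of `SL₂(F)`; Rogawski (1990) §3.6 p. 31: `SU(1,1) ≅ SL₂(F)`)

Topic `NumberTheory/Automorphic`; namespace `Literature.NumberTheory.Automorphic.UnitaryGroup`.  KERNEL mathematics only: theorems, no definition, no named fact, no
instance, no notation, no `sorry`.  Cell `pub/hodgecm-mathlib`, F0∕P3a, crux H413 = `stmt-HodgeConjecture-24833`, line «N6nsGerm», residue «R2EP-wild» of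
`stub_N6nsR2EP : RankOneEulerPoincareNonsplit` (census of record `F0/P3a/F0P3a-p04/g13/MEMO-R2wild.F0P3a-p04g13.md`, LEAD WORD T9-17 (3); ROAD W brick (W1):
the homomorphism `ρ : U(Φ₂)(E_w) → PGL₂(F_v)` through which `U` acts on the tree of `SL₂(F_v)` (★ (W0) `isTree_latticeTree_id_altJ`); seat F0P3a-p04 (g13)).
HONEST LABEL: HC_CM is proved only modulo the printed citations until rung 0 closes; nothing printed is asserted here.

THE MATHEMATICS (`K` a field, `σ : K →+* K`, `Φ := (0 1; 1 0)`, `u ∈ U(σ, Φ) = {u : σ(u)ᵀ Φ u = Φ}`, `δ := det u`).  §1 The four unitarity relations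
`σc·a + σa·c = 0`, `σc·b + σa·d = 1`, `σd·a + σb·c = 1`, `σd·b + σb·d = 0` (`u = (a b; c d)`) solve to **`σa = a∕δ`, `σb = −b∕δ`, `σc = −c∕δ`, `σd = d∕δ`** — i.e.
`σ(u) = δ⁻¹ · D u D`, `D = diag(−1, 1)` — whence `σ(δ) δ = 1`.  §2 For `α` with `σα = −α ≠ 0` and `u′ := diag(1,α) u diag(1,α)⁻¹ = (a, b∕α; αc, d)`:
**`σ(u′) = δ⁻¹ · u′`** (every entry of `u′` is a `δ⁻¹`-eigenvector of `σ`), so for any `s ≠ 0` with `δ · σ(s) = s` (Hilbert 90) the matrix `s⁻¹ u′` is `σ`-FIXED.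
§3 At a non-split place `w ∣ v` of a quadratic extension `E ∕ F` of number fields (`σ = σ_w`): `σ_w`-fixed elements come from `F_v` (★
`exists_toPlace_eq_of_galAdicCompletionMap_eq`) and Hilbert 90 holds (★ `exists_ne_zero_mul_galAdicCompletionMap_eq`), so **`diag(1,α) u diag(1,α)⁻¹ = s · ι_w(g)` with
`s ∈ E_w^×`, `g ∈ GL₂(F_v)`**: `Ad(diag(1,α))` followed by «divide by the scalar» is the map `ρ : U(Φ₂)(E_w) → PGL₂(F_v)` of the memo (§1 (S2)), at EVERY non-split
place (inert, tame, wild).  NOT here: multiplicativity of `ρ` modulo scalars (immediate from the formula), its image `{det ∈ N(E_w^×)}`, the tree action (W1c).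

## References
* [Serre1980Trees] J.-P. Serre, *Trees* (1980), Ch. II §1.2–§1.3 (`GL₂`, `SL₂`, `PGL₂` acting on the tree).
* [Tits1979] J. Tits, *Reductive groups over local fields*, PSPM 33.1 (1979), §2.7 (quasi-split `SU₃`∕unitary examples), §3.9.
* [Rogawski1990] J. D. Rogawski, *Automorphic Representations of Unitary Groups in Three Variables* (1990), §3.6 p. 31 (`U(1,1)`, `SU(1,1) ≅ SL₂`).
-/

set_option autoImplicit false

noncomputable section

open Matrix NumberField IsDedekindDomain
open scoped Matrix MatrixGroups

namespace Literature.NumberTheory.Automorphic.UnitaryGroup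

/-! ## §1 `σ(u) = (det u)⁻¹ · D u D` on `U(σ, Φ₂)` -/

section Field

variable {K : Type*} [Field K] (σ : K →+* K)

/-- The four unitarity relations of `u = (a b; c d) ∈ U(σ, Φ₂)`: `σc·a + σa·c = 0`, `σc·b + σa·d = 1`, `σd·a + σb·c = 1`, `σd·b + σb·d = 0`. [cite: Rogawski1990, §3.6 p. 31] -/
theorem unitarity_relations_antidiag_two {u : GL (Fin 2) K} (hu : u ∈ unitaryGroupOfForm σ !![(0 : K), 1; 1, 0]) :
    σ ((u : Matrix (Fin 2) (Fin 2) K) 1 0) * (u : Matrix (Fin 2) (Fin 2) K) 0 0 + σ ((u : Matrix (Fin 2) (Fin 2) K) 0 0) * (u : Matrix (Fin 2) (Fin 2) K) 1 0 = 0 ∧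
    σ ((u : Matrix (Fin 2) (Fin 2) K) 1 0) * (u : Matrix (Fin 2) (Fin 2) K) 0 1 + σ ((u : Matrix (Fin 2) (Fin 2) K) 0 0) * (u : Matrix (Fin 2) (Fin 2) K) 1 1 = 1 ∧
    σ ((u : Matrix (Fin 2) (Fin 2) K) 1 1) * (u : Matrix (Fin 2) (Fin 2) K) 0 0 + σ ((u : Matrix (Fin 2) (Fin 2) K) 0 1) * (u : Matrix (Fin 2) (Fin 2) K) 1 0 = 1 ∧
    σ ((u : Matrix (Fin 2) (Fin 2) K) 1 1) * (u : Matrix (Fin 2) (Fin 2) K) 0 1 + σ ((u : Matrix (Fin 2) (Fin 2) K) 0 1) * (u : Matrix (Fin 2) (Fin 2) K) 1 1 = 0 := by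
  have h : ((u : Matrix (Fin 2) (Fin 2) K).map σ)ᵀ * !![(0 : K), 1; 1, 0] * (u : Matrix (Fin 2) (Fin 2) K) = !![(0 : K), 1; 1, 0] :=
    mem_unitaryGroupOfForm_iff.1 hu
  have h00 := congrFun (congrFun h 0) 0
  have h01 := congrFun (congrFun h 0) 1
  have h10 := congrFun (congrFun h 1) 0
  have h11 := congrFun (congrFun h 1) 1
  simp [Matrix.mul_apply, Fin.sum_univ_two] at h00 h01 h10 h11
  exact ⟨by linear_combination h00, by linear_combination h01, by linear_combination h10, by linear_combination h11⟩

/-- **`σ` ON THE ENTRIES OF `u ∈ U(σ, Φ₂)`**: `σa = a∕δ`, `σb = −b∕δ`, `σc = −c∕δ`, `σd = d∕δ` with `δ = det u` (solve the unitarity relations; equivalently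
`σ(u) = δ⁻¹·DuD`, `D = diag(−1,1)`, from `σ(u)ᵀ = Φ u⁻¹ Φ` and the `2 × 2` adjugate). [cite: Rogawski1990, §3.6 p. 31] [cite: Serre1980Trees, Ch. II §1.2] -/
theorem map_entries_eq_of_mem_unitaryGroupOfForm_antidiag_two {u : GL (Fin 2) K} (hu : u ∈ unitaryGroupOfForm σ !![(0 : K), 1; 1, 0]) :
    σ ((u : Matrix (Fin 2) (Fin 2) K) 0 0) = ((u : Matrix (Fin 2) (Fin 2) K).det)⁻¹ * (u : Matrix (Fin 2) (Fin 2) K) 0 0 ∧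
    σ ((u : Matrix (Fin 2) (Fin 2) K) 0 1) = -(((u : Matrix (Fin 2) (Fin 2) K).det)⁻¹ * (u : Matrix (Fin 2) (Fin 2) K) 0 1) ∧
    σ ((u : Matrix (Fin 2) (Fin 2) K) 1 0) = -(((u : Matrix (Fin 2) (Fin 2) K).det)⁻¹ * (u : Matrix (Fin 2) (Fin 2) K) 1 0) ∧
    σ ((u : Matrix (Fin 2) (Fin 2) K) 1 1) = ((u : Matrix (Fin 2) (Fin 2) K).det)⁻¹ * (u : Matrix (Fin 2) (Fin 2) K) 1 1 := by
  obtain ⟨h1, h2, h3, h4⟩ := unitarity_relations_antidiag_two σ hu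
  have hdet : (u : Matrix (Fin 2) (Fin 2) K).det ≠ 0 := by
    have h := u.isUnit.map Matrix.detMonoidHom
    exact (isUnit_iff_ne_zero.1 h)
  set a := (u : Matrix (Fin 2) (Fin 2) K) 0 0
  set b := (u : Matrix (Fin 2) (Fin 2) K) 0 1
  set c := (u : Matrix (Fin 2) (Fin 2) K) 1 0
  set d := (u : Matrix (Fin 2) (Fin 2) K) 1 1
  have hδ : (u : Matrix (Fin 2) (Fin 2) K).det = a * d - b * c := Matrix.det_fin_two _
  rw [hδ] at hdet ⊢
  refine ⟨?_, ?_, ?_, ?_⟩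
  · rw [show (a * d - b * c)⁻¹ * a = a * (a * d - b * c)⁻¹ by ring, eq_mul_inv_iff_mul_eq₀ hdet]
    linear_combination a * h2 - b * h1
  · rw [show -((a * d - b * c)⁻¹ * b) = (-b) * (a * d - b * c)⁻¹ by ring, eq_mul_inv_iff_mul_eq₀ hdet]
    linear_combination a * h4 - b * h3
  · rw [show -((a * d - b * c)⁻¹ * c) = (-c) * (a * d - b * c)⁻¹ by ring, eq_mul_inv_iff_mul_eq₀ hdet]
    linear_combination d * h1 - c * h2
  · rw [show (a * d - b * c)⁻¹ * d = d * (a * d - b * c)⁻¹ by ring, eq_mul_inv_iff_mul_eq₀ hdet]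
    linear_combination d * h3 - c * h4

/-- **`det u · σ(det u) = 1`** for `u ∈ U(σ, Φ₂)` (take determinants in `σ(u) = δ⁻¹ DuD`). [cite: Rogawski1990, §3.6 p. 31] -/
theorem det_mul_map_det_eq_one_of_mem_unitaryGroupOfForm_antidiag_two {u : GL (Fin 2) K} (hu : u ∈ unitaryGroupOfForm σ !![(0 : K), 1; 1, 0]) :
    (u : Matrix (Fin 2) (Fin 2) K).det * σ ((u : Matrix (Fin 2) (Fin 2) K).det) = 1 := by
  obtain ⟨h1, h2, h3, h4⟩ := map_entries_eq_of_mem_unitaryGroupOfForm_antidiag_two σ hu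
  have hdet : (u : Matrix (Fin 2) (Fin 2) K).det ≠ 0 := by
    have h := u.isUnit.map Matrix.detMonoidHom
    exact (isUnit_iff_ne_zero.1 h)
  rw [Matrix.det_fin_two] at h1 h2 h3 h4 hdet ⊢
  rw [map_sub, map_mul, map_mul, h1, h2, h3, h4]
  set δ := (u : Matrix (Fin 2) (Fin 2) K) 0 0 * (u : Matrix (Fin 2) (Fin 2) K) 1 1 - (u : Matrix (Fin 2) (Fin 2) K) 0 1 * (u : Matrix (Fin 2) (Fin 2) K) 1 0
  have key : δ⁻¹ * (u : Matrix (Fin 2) (Fin 2) K) 0 0 * (δ⁻¹ * (u : Matrix (Fin 2) (Fin 2) K) 1 1) -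
      -(δ⁻¹ * (u : Matrix (Fin 2) (Fin 2) K) 0 1) * -(δ⁻¹ * (u : Matrix (Fin 2) (Fin 2) K) 1 0) = δ⁻¹ * (δ⁻¹ * δ) := by ring
  rw [key, inv_mul_cancel₀ hdet, mul_one, mul_inv_cancel₀ hdet]

/-! ## §2 Conjugating by `diag(1, α)`, `σα = −α`: every entry becomes a `δ⁻¹`-eigenvector of `σ` -/

/-- The entries of `u′ := diag(1,α) u diag(1,α⁻¹) = (a, b∕α; αc, d)`. [cite: Serre1980Trees, Ch. II §1.2] -/
theorem diagonal_mul_mul_diagonal_apply (u : Matrix (Fin 2) (Fin 2) K) (α : K) :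
    (diagonal ![1, α] * u * diagonal ![1, α⁻¹]) 0 0 = u 0 0 ∧ (diagonal ![1, α] * u * diagonal ![1, α⁻¹]) 0 1 = u 0 1 * α⁻¹ ∧
      (diagonal ![1, α] * u * diagonal ![1, α⁻¹]) 1 0 = α * u 1 0 ∧ (diagonal ![1, α] * u * diagonal ![1, α⁻¹]) 1 1 = α * u 1 1 * α⁻¹ := by
  simp [Matrix.mul_apply, diagonal]

/-- **`σ(u′) = (det u)⁻¹ · u′`** for `u′ = diag(1,α) u diag(1,α)⁻¹`, `u ∈ U(σ, Φ₂)`, `σα = −α`, `α ≠ 0`: the conjugate by `diag(1,α)` is `σ`-fixed UP TO THE SCALAR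
`(det u)⁻¹` (memo §1 (S2): `Ad(diag(1,α)) U ⊂ K^× · GL₂(K^σ)`). [cite: Serre1980Trees, Ch. II §1.2] [cite: Tits1979, §2.7] -/
theorem map_conj_diagonal_eq_det_inv_smul {u : GL (Fin 2) K} (hu : u ∈ unitaryGroupOfForm σ !![(0 : K), 1; 1, 0]) {α : K} (hα : σ α = -α) (hα0 : α ≠ 0) :
    (diagonal ![1, α] * (u : Matrix (Fin 2) (Fin 2) K) * diagonal ![1, α⁻¹]).map σ =
      ((u : Matrix (Fin 2) (Fin 2) K).det)⁻¹ • (diagonal ![1, α] * (u : Matrix (Fin 2) (Fin 2) K) * diagonal ![1, α⁻¹]) := by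
  obtain ⟨h1, h2, h3, h4⟩ := map_entries_eq_of_mem_unitaryGroupOfForm_antidiag_two σ hu
  obtain ⟨e1, e2, e3, e4⟩ := diagonal_mul_mul_diagonal_apply (u : Matrix (Fin 2) (Fin 2) K) α
  have hσα0 : σ α ≠ 0 := by rw [hα]; exact neg_ne_zero.2 hα0
  ext i j
  fin_cases i <;> fin_cases j
  · simp only [Matrix.map_apply, Matrix.smul_apply, smul_eq_mul, Fin.zero_eta, Fin.isValue]
    rw [e1, h1]
  · simp only [Matrix.map_apply, Matrix.smul_apply, smul_eq_mul, Fin.zero_eta, Fin.mk_one, Fin.isValue]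
    rw [e2, map_mul, map_inv₀, h2, hα]
    field_simp
  · simp only [Matrix.map_apply, Matrix.smul_apply, smul_eq_mul, Fin.zero_eta, Fin.mk_one, Fin.isValue]
    rw [e3, map_mul, h3, hα]
    ring
  · simp only [Matrix.map_apply, Matrix.smul_apply, smul_eq_mul, Fin.mk_one, Fin.isValue]
    rw [e4, map_mul, map_mul, map_inv₀, h4, hα]
    field_simp

/-- **HILBERT-90 NORMALISATION**: if moreover `s ≠ 0` and `det u · σ(s) = s`, then `s⁻¹ · diag(1,α) u diag(1,α)⁻¹` is `σ`-FIXED entrywise.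
[cite: Serre1980Trees, Ch. II §1.2] [cite: Tits1979, §2.7] -/
theorem map_smul_conj_diagonal_eq_self {u : GL (Fin 2) K} (hu : u ∈ unitaryGroupOfForm σ !![(0 : K), 1; 1, 0]) {α : K} (hα : σ α = -α) (hα0 : α ≠ 0)
    {s : K} (hs0 : s ≠ 0) (hs : (u : Matrix (Fin 2) (Fin 2) K).det * σ s = s) :
    (s⁻¹ • (diagonal ![1, α] * (u : Matrix (Fin 2) (Fin 2) K) * diagonal ![1, α⁻¹])).map σ =
      s⁻¹ • (diagonal ![1, α] * (u : Matrix (Fin 2) (Fin 2) K) * diagonal ![1, α⁻¹]) := by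
  have hdet : (u : Matrix (Fin 2) (Fin 2) K).det ≠ 0 := by
    have h := u.isUnit.map Matrix.detMonoidHom
    exact (isUnit_iff_ne_zero.1 h)
  have hσs : σ s = ((u : Matrix (Fin 2) (Fin 2) K).det)⁻¹ * s := by
    rw [eq_inv_mul_iff_mul_eq₀ hdet, hs]
  have hsm : (s⁻¹ • (diagonal ![1, α] * (u : Matrix (Fin 2) (Fin 2) K) * diagonal ![1, α⁻¹])).map σ =
      σ s⁻¹ • (diagonal ![1, α] * (u : Matrix (Fin 2) (Fin 2) K) * diagonal ![1, α⁻¹]).map σ := by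
    ext i j
    simp only [Matrix.map_apply, Matrix.smul_apply, smul_eq_mul, map_mul]
  rw [hsm, map_inv₀, map_conj_diagonal_eq_det_inv_smul σ hu hα hα0, smul_smul, hσs, mul_inv, inv_inv]
  congr 1
  field_simp

end Field

/-! ## §3 At a non-split place: `diag(1,α) u diag(1,α)⁻¹ = s · ι_w(g)`, `g ∈ GL₂(F_v)` -/

section Place

variable {F E : Type} [Field F] [NumberField F] [Field E] [NumberField E] [Algebra F E] [Algebra.IsQuadraticExtension F E]
  (c : E ≃ₐ[F] E) {v : HeightOneSpectrum (𝓞 F)} (w : PlacesOver E v)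

/-- **`Ad(diag(1,α))(U(Φ₂)(E_w)) ⊂ E_w^× · GL₂(F_v)` at a NON-SPLIT place** (`c • w = w`, `c ≠ 1`; `σ_w α = −α ≠ 0`): for `u ∈ U(σ_w, Φ₂)` there are `s ∈ E_w`, `s ≠ 0`,
and `g ∈ GL₂(F_v)` with `diag(1,α) u diag(1,α)⁻¹ = s · ι_w(g)` (Hilbert 90 ★ `exists_ne_zero_mul_galAdicCompletionMap_eq` for `δ = det u` + descent of `σ_w`-fixed
elements ★ `exists_toPlace_eq_of_galAdicCompletionMap_eq`).  This is the map `ρ : U(Φ₂)(E_w) → PGL₂(F_v)`, `u ↦ [g]`, of the «R2EP-wild» census, through which `U`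
acts on the tree of `SL₂(F_v)` at every non-split place. [cite: Serre1980Trees, Ch. II §1.2–§1.3] [cite: Tits1979, §2.7 and §3.9] -/
theorem exists_conj_diagonal_eq_smul_map_toPlace (hc : c ≠ 1) (hw : c • w.1 = w.1) {α : w.1.adicCompletion E}
    (hα : galAdicCompletionMap (L := E) c hw α = -α) (hα0 : α ≠ 0) {u : GL (Fin 2) (w.1.adicCompletion E)}
    (hu : u ∈ unitaryGroupOfForm (galAdicCompletionMap (L := E) c hw) !![(0 : w.1.adicCompletion E), 1; 1, 0]) :
    ∃ (s : w.1.adicCompletion E) (g : GL (Fin 2) (v.adicCompletion F)), s ≠ 0 ∧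
      diagonal ![1, α] * (u : Matrix (Fin 2) (Fin 2) (w.1.adicCompletion E)) * diagonal ![1, α⁻¹] =
        s • (g : Matrix (Fin 2) (Fin 2) (v.adicCompletion F)).map (toPlace v w) := by
  haveI : Algebra.IsSeparable F E := inferInstance
  set σ := galAdicCompletionMap (L := E) c hw with hσdef
  set u' : Matrix (Fin 2) (Fin 2) (w.1.adicCompletion E) := diagonal ![1, α] * (u : Matrix (Fin 2) (Fin 2) (w.1.adicCompletion E)) * diagonal ![1, α⁻¹]
    with hu'def
  -- Hilbert 90 for `δ = det u`
  have hδ : (u : Matrix (Fin 2) (Fin 2) (w.1.adicCompletion E)).det * σ ((u : Matrix (Fin 2) (Fin 2) (w.1.adicCompletion E)).det) = 1 :=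
    det_mul_map_det_eq_one_of_mem_unitaryGroupOfForm_antidiag_two σ hu
  obtain ⟨s, hs0, hs, -⟩ := Liu2021.exists_ne_zero_mul_galAdicCompletionMap_eq F E c (algEquiv_mul_self_eq_one F hc) hc hw hδ
  -- `s⁻¹ u′` is `σ_w`-fixed entrywise, hence comes from `F_v`
  have hfix : (s⁻¹ • u').map σ = s⁻¹ • u' := map_smul_conj_diagonal_eq_self σ hu hα hα0 hs0 hs
  have hentry : ∀ i j, ∃ p : v.adicCompletion F, toPlace v w p = (s⁻¹ • u') i j := by
    intro i j
    refine exists_toPlace_eq_of_galAdicCompletionMap_eq c w hc hw _ ?_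
    have h := congrFun (congrFun hfix i) j
    rwa [Matrix.map_apply] at h
  choose p hp using hentry
  set g₀ : Matrix (Fin 2) (Fin 2) (v.adicCompletion F) := Matrix.of fun i j => p i j with hg₀def
  have hg₀map : g₀.map (toPlace v w) = s⁻¹ • u' := by
    ext i j
    rw [Matrix.map_apply, hg₀def, Matrix.of_apply, hp]
  -- `g₀` is invertible: `det` is non-zero after `ι_w`
  have hdetu : (u : Matrix (Fin 2) (Fin 2) (w.1.adicCompletion E)).det ≠ 0 := by
    have h := u.isUnit.map Matrix.detMonoidHom
    exact (isUnit_iff_ne_zero.1 h)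
  have hdet' : u'.det ≠ 0 := by
    rw [hu'def, Matrix.det_mul, Matrix.det_mul, Matrix.det_diagonal, Matrix.det_diagonal]
    simp [Fin.prod_univ_two, hα0, hdetu]
  have hdetg₀ : g₀.det ≠ 0 := by
    intro h0
    have h1 : (g₀.map (toPlace v w)).det = 0 := by rw [← RingHom.mapMatrix_apply, ← RingHom.map_det, h0, map_zero]
    rw [hg₀map, Matrix.det_smul, Fintype.card_fin] at h1
    exact (mul_ne_zero (pow_ne_zero _ (inv_ne_zero hs0)) hdet') h1
  refine ⟨s, Matrix.GeneralLinearGroup.mkOfDetNeZero g₀ hdetg₀, hs0, ?_⟩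
  rw [Matrix.GeneralLinearGroup.val_mkOfDetNeZero, hg₀map, smul_smul, mul_inv_cancel₀ hs0, one_smul]

end Place

end Literature.NumberTheory.Automorphic.UnitaryGroup
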